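import Summits.QuantumFields.YangMills.Theorems.LuscherReductionDressedRitzPolyakovLiftReflectionSymmetry
import Summits.QuantumFields.YangMills.Theorems.LuscherReductionDressedRitzPolyakovLiftDressedLinear
import HarnessLib

/-!
# Line «polyakovlift» on crux `DressedRitz` (stmt-QuantumFields-20205), stubs S-STAT ∕ S-POS: ∀-BASIS ROBUSTNESS INSIDE A SYMMETRY MULTIPLET —
# a scalar Gram ∕ coupling block is preserved by every orthogonal recombination, so (o2) and (o6) are exact for EVERY basis of the multiplet

Fleet-service module of seat ym-infvol-p1 g6 (route `LuscherReduction`, femto rung R2b1; bears on the crux child `DressedRitz` = stmt-QuantumFields-20205,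
skeleton r4 `11e28270fd13c0fc`).  The symmetry zeros of `…PolyakovLiftReflectionSymmetry.lean` ∕ `…ParitySymmetry.lean` (this seat) and of seat g5
are stated for a SYMMETRY-ADAPTED pair of channels.  The registered stubs quantify over EVERY lift basis (`LiftBasis`: the one-site eigen-ratios are
free up to rotations inside a degenerate one-site multiplet — the standing disprover's (G1-b)∕(T2) hazard, owner's (R-c) fallback).  This module closes
that gap for multiplets whose symmetry-adapted basis has a SCALAR Gram block and a SCALAR coupling block:

* §1 finite linearity on the fine lattice (`isPhys_sum_smul`, `l2_sum_smul_left`) and the dressed numbers of finite recombinations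
  (`l2_dressed_recombine`, `l2_dressed_transferApply_recombine`: `N(Σ pₐfₐ, Σ q_b f_b) = Σₐ Σ_b pₐ q_b N(fₐ,f_b)`, same for `D(f,h) = ⟨u'_f, K_β u'_h⟩`;
  tree T1 `dressedLiftVec_sum_smul`);
* §2 ★ `l2_dressed_recombine_of_scalar`: if `N(fₐ,f_b) = c·δ_ab` then `N(Σ pₐfₐ, Σ q_b f_b) = c·Σₐ pₐqₐ` — ZERO for orthogonal coefficient rows, and
  the SAME constant `c` on the diagonal for unit rows; likewise for `D`;
* §3 ★★ `dressedLiftFamily_o2_o6_of_scalarBlock`: for a lift basis `g` whose channels `g_i`, `g_l` are recombinations `Σₐ pₐ fₐ`, `Σₐ qₐ fₐ` with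
  `Σ pₐqₐ = 0` of a finite physical family `f` with scalar Gram and coupling blocks, clause (o2) of S-STAT and clause (o6) of S-POS hold with ANY
  `C ≥ 0`.  Typical use: `f` = the axis-adapted basis of an O_h-triplet (pairwise zeros by the axis-reflection parities of `…ParitySymmetry.lean`,
  equal diagonal entries by the axis permutations — `l2_dressed_diag_eq_of_symmetry`), `g_i, g_l` = any two members of a rotated basis of its span.

HONEST FRAMING: fixed-lattice bilinear bookkeeping on the conditional femto rung R2b1; no renormalisation-group content; nothing here bears on infinite
volume, the continuum limit or the Clay gap.  References: M. Lüscher, NPB 219 (1983) 233, §2 [cite: Luscher1983, §2]; M. Lüscher, U. Wolff, NPB 339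
(1990) 222 [cite: LuscherWolff1990].
-/

set_option autoImplicit false

noncomputable section

open MeasureTheory Filter Topology Real
open Literature.MathematicalPhysics.QuantumFieldTheory
open scoped BigOperators

namespace Summit.QuantumFields.YangMills.Theorems.FemtoTransferGap.PolyakovLift

open Summit.QuantumFields.YangMills.Theorems.FemtoTransferGap

/-! ## §1 Finite linearity on the fine lattice; dressed numbers of recombinations -/

section Linear

variable {L : ℕ} [NeZero L] {n : ℕ}

omit [NeZero L] in
/-- Finite partial combinations `Σ_{a ∈ s} cₐ • ψₐ` of physical fine test functions are physical. [folklore] -/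
theorem isPhys_finset_sum_smul {ψ : Fin n → (GaugeConfig 3 L SU2 → ℝ)} (hψ : ∀ a, IsPhys (ψ a)) (c : Fin n → ℝ) (s : Finset (Fin n)) :
    IsPhys (∑ a ∈ s, c a • ψ a) := by
  classical
  induction s using Finset.induction_on with
  | empty => rw [Finset.sum_empty]; exact isPhys_const 0
  | insert j s hj ih => rw [Finset.sum_insert hj]; exact ((hψ j).smul (c j)).add ih

omit [NeZero L] in
/-- Finite combinations `Σₐ cₐ • ψₐ` of physical fine test functions are physical. [folklore] -/
theorem isPhys_sum_smul {ψ : Fin n → (GaugeConfig 3 L SU2 → ℝ)} (hψ : ∀ a, IsPhys (ψ a)) (c : Fin n → ℝ) :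
    IsPhys (∑ a, c a • ψ a) :=
  isPhys_finset_sum_smul hψ c Finset.univ

/-- `⟨Σ_{a ∈ s} cₐ • ψₐ, χ⟩ = Σ_{a ∈ s} cₐ ⟨ψₐ, χ⟩` for physical `ψₐ`, `χ`. [folklore] -/
theorem l2_finset_sum_smul_left {ψ : Fin n → (GaugeConfig 3 L SU2 → ℝ)} (hψ : ∀ a, IsPhys (ψ a)) {χ : GaugeConfig 3 L SU2 → ℝ} (hχ : IsPhys χ)
    (c : Fin n → ℝ) (s : Finset (Fin n)) : l2 (∑ a ∈ s, c a • ψ a) χ = ∑ a ∈ s, c a * l2 (ψ a) χ := by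
  classical
  induction s using Finset.induction_on with
  | empty =>
    rw [Finset.sum_empty, Finset.sum_empty, show (0 : GaugeConfig 3 L SU2 → ℝ) = (0 : ℝ) • χ by rw [zero_smul], l2_smul_left, zero_mul]
  | insert j s hj ih =>
    rw [Finset.sum_insert hj, Finset.sum_insert hj, l2_add_left ((hψ j).smul (c j)) (isPhys_finset_sum_smul hψ c s) hχ, l2_smul_left, ih]

/-- `⟨Σₐ cₐ • ψₐ, χ⟩ = Σₐ cₐ ⟨ψₐ, χ⟩` for physical `ψₐ`, `χ`. [folklore] -/
theorem l2_sum_smul_left {ψ : Fin n → (GaugeConfig 3 L SU2 → ℝ)} (hψ : ∀ a, IsPhys (ψ a)) {χ : GaugeConfig 3 L SU2 → ℝ} (hχ : IsPhys χ)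
    (c : Fin n → ℝ) : l2 (∑ a, c a • ψ a) χ = ∑ a, c a * l2 (ψ a) χ :=
  l2_finset_sum_smul_left hψ hχ c Finset.univ

/-- The dressed lift of a recombination `Σₐ pₐ fₐ` of physical one-site functions is the recombination of the dressed lifts (tree T1). [cite: LuscherWolff1990] -/
theorem dressedLiftVec_recombine (β : ℝ) {φ : GaugeConfig 3 L SU2 → ℝ} (hφ : IsPhys φ) {f : Fin n → (GaugeConfig 3 1 SU2 → ℝ)}
    (hf : ∀ a, IsPhys (f a)) (p : Fin n → ℝ) :
    dressedLiftVec β φ (fun V => ∑ a, p a * f a V) = ∑ a, p a • dressedLiftVec β φ (f a) :=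
  dressedLiftVec_sum_smul β hφ hf p

/-- **Gram numbers of recombinations**: `N(Σₐ pₐfₐ, Σ_b q_b f_b) = Σₐ Σ_b pₐ q_b N(fₐ, f_b)`, `N(f,h) = ⟨u'_f, u'_h⟩`. [folklore] -/
theorem l2_dressed_recombine (β : ℝ) {φ : GaugeConfig 3 L SU2 → ℝ} (hφ : IsPhys φ) {f : Fin n → (GaugeConfig 3 1 SU2 → ℝ)}
    (hf : ∀ a, IsPhys (f a)) (p q : Fin n → ℝ) :
    l2 (dressedLiftVec β φ fun V => ∑ a, p a * f a V) (dressedLiftVec β φ fun V => ∑ b, q b * f b V) =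
      ∑ a, ∑ b, p a * q b * l2 (dressedLiftVec β φ (f a)) (dressedLiftVec β φ (f b)) := by
  have hu : ∀ a, IsPhys (dressedLiftVec β φ (f a)) := fun a => isPhys_dressedLiftVec β hφ (hf a)
  rw [dressedLiftVec_recombine β hφ hf p, dressedLiftVec_recombine β hφ hf q,
    l2_sum_smul_left hu (isPhys_sum_smul hu q) p]
  refine Finset.sum_congr rfl fun a _ => ?_
  rw [l2_comm, l2_sum_smul_left hu (hu a) q, Finset.mul_sum]
  refine Finset.sum_congr rfl fun b _ => ?_
  rw [l2_comm]; ring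

/-- **Coupling numbers of recombinations**: `D(Σₐ pₐfₐ, Σ_b q_b f_b) = Σₐ Σ_b pₐ q_b D(fₐ, f_b)`, `D(f,h) = ⟨u'_f, K_β u'_h⟩`. [folklore] -/
theorem l2_dressed_transferApply_recombine (β : ℝ) {φ : GaugeConfig 3 L SU2 → ℝ} (hφ : IsPhys φ) {f : Fin n → (GaugeConfig 3 1 SU2 → ℝ)}
    (hf : ∀ a, IsPhys (f a)) (p q : Fin n → ℝ) :
    l2 (dressedLiftVec β φ fun V => ∑ a, p a * f a V) (transferApply β (dressedLiftVec β φ fun V => ∑ b, q b * f b V)) =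
      ∑ a, ∑ b, p a * q b * l2 (dressedLiftVec β φ (f a)) (transferApply β (dressedLiftVec β φ (f b))) := by
  have hu : ∀ a, IsPhys (dressedLiftVec β φ (f a)) := fun a => isPhys_dressedLiftVec β hφ (hf a)
  have hKu : ∀ a, IsPhys (transferApply β (dressedLiftVec β φ (f a))) := fun a => isPhys_transferApply β (hu a)
  have hK : transferApply β (dressedLiftVec β φ fun V => ∑ b, q b * f b V) = ∑ b, q b • transferApply β (dressedLiftVec β φ (f b)) := by
    rw [dressedLiftVec_recombine β hφ hf q]
    have h := iterate_transferApply_sum_smul β 1 hu q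
    simpa only [Function.iterate_one] using h
  rw [dressedLiftVec_recombine β hφ hf p, hK, l2_sum_smul_left hu (isPhys_sum_smul hKu q) p]
  refine Finset.sum_congr rfl fun a _ => ?_
  rw [l2_comm, l2_sum_smul_left hKu (hu a) q, Finset.mul_sum]
  refine Finset.sum_congr rfl fun b _ => ?_
  rw [l2_comm]; ring

end Linear

/-! ## §2 ★ Scalar blocks are preserved by orthogonal recombination -/

section Scalar

variable {L : ℕ} [NeZero L] {n : ℕ}

/-- Pure algebra: `Σₐ Σ_b pₐ q_b (c·δ_ab) = c·Σₐ pₐ qₐ`. [folklore] -/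
theorem sum_sum_mul_ite_eq (p q : Fin n → ℝ) (c : ℝ) :
    ∑ a, ∑ b, p a * q b * (if a = b then c else 0) = c * ∑ a, p a * q a := by
  rw [Finset.mul_sum]
  refine Finset.sum_congr rfl fun a _ => ?_
  rw [Finset.sum_eq_single a (fun b _ hb => by rw [if_neg (Ne.symm hb), mul_zero]) (fun h => absurd (Finset.mem_univ a) h), if_pos rfl]
  ring

/-- ★ **A scalar Gram block is preserved by recombination**: if `N(fₐ, f_b) = c·δ_ab` then `N(Σ pₐfₐ, Σ q_b f_b) = c·Σₐ pₐqₐ` — zero for orthogonal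
rows, `c` again for unit rows. [cite: Luscher1983, §2] -/
theorem l2_dressed_recombine_of_scalar (β : ℝ) {φ : GaugeConfig 3 L SU2 → ℝ} (hφ : IsPhys φ) {f : Fin n → (GaugeConfig 3 1 SU2 → ℝ)}
    (hf : ∀ a, IsPhys (f a)) {c : ℝ} (hN : ∀ a b, l2 (dressedLiftVec β φ (f a)) (dressedLiftVec β φ (f b)) = if a = b then c else 0)
    (p q : Fin n → ℝ) :
    l2 (dressedLiftVec β φ fun V => ∑ a, p a * f a V) (dressedLiftVec β φ fun V => ∑ b, q b * f b V) = c * ∑ a, p a * q a := by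
  rw [l2_dressed_recombine β hφ hf p q]
  simp_rw [hN]
  exact sum_sum_mul_ite_eq p q c

/-- ★ **A scalar coupling block is preserved by recombination**: if `D(fₐ, f_b) = d·δ_ab` then `D(Σ pₐfₐ, Σ q_b f_b) = d·Σₐ pₐqₐ`. [cite: Luscher1983, §2] -/
theorem l2_dressed_transferApply_recombine_of_scalar (β : ℝ) {φ : GaugeConfig 3 L SU2 → ℝ} (hφ : IsPhys φ)
    {f : Fin n → (GaugeConfig 3 1 SU2 → ℝ)} (hf : ∀ a, IsPhys (f a)) {d : ℝ}
    (hD : ∀ a b, l2 (dressedLiftVec β φ (f a)) (transferApply β (dressedLiftVec β φ (f b))) = if a = b then d else 0)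
    (p q : Fin n → ℝ) :
    l2 (dressedLiftVec β φ fun V => ∑ a, p a * f a V) (transferApply β (dressedLiftVec β φ fun V => ∑ b, q b * f b V)) = d * ∑ a, p a * q a := by
  rw [l2_dressed_transferApply_recombine β hφ hf p q]
  simp_rw [hD]
  exact sum_sum_mul_ite_eq p q d

/-- **Equal diagonal entries from a symmetry**: if `σ` leaves the two-time forms at flow time `L²/√λ` invariant and maps `f` to `ε·f'` with `ε² = 1`
(`f ∘ σ = ε f'`), then `N(f,f) = N(f',f')` and `D(f,f) = D(f',f')` — e.g. the members of a `T`-triplet permuted (up to sign) by axis permutations.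
[cite: Luscher1983, §2] -/
theorem l2_dressed_diag_eq_of_symmetry (β : ℝ) {φ : GaugeConfig 3 L SU2 → ℝ} (hφ : IsPhys φ)
    (σ : GaugeConfig 3 1 SU2 → GaugeConfig 3 1 SU2)
    (hσinv : ∀ (F H : GaugeConfig 3 1 SU2 → ℝ) (a b : ℕ),
      l2 ((transferApply β)^[a] (OpPlat.ins φ (flowLiftAt (L := L) 0 (flowTime β L) fun V => F (σ V))))
          ((transferApply β)^[b] (OpPlat.ins φ (flowLiftAt 0 (flowTime β L) fun V => H (σ V)))) =
        l2 ((transferApply β)^[a] (OpPlat.ins φ (flowLiftAt (L := L) 0 (flowTime β L) F)))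
          ((transferApply β)^[b] (OpPlat.ins φ (flowLiftAt 0 (flowTime β L) H))))
    {f f' : GaugeConfig 3 1 SU2 → ℝ} (hf' : IsPhys f') {ε : ℝ} (hε : ε ^ 2 = 1) (hmap : ∀ V, f (σ V) = ε * f' V) :
    l2 (dressedLiftVec β φ f) (dressedLiftVec β φ f) = l2 (dressedLiftVec β φ f') (dressedLiftVec β φ f') ∧
      l2 (dressedLiftVec β φ f) (transferApply β (dressedLiftVec β φ f)) =
        l2 (dressedLiftVec β φ f') (transferApply β (dressedLiftVec β φ f')) := by
  -- `f ∘ σ` as a one-term recombination of `f'`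
  have hrec : (fun V => f (σ V)) = fun V => ∑ a : Fin 1, (fun _ => ε) a * (fun _ => f') a V := by
    funext V; simp only [Finset.univ_unique, Fin.default_eq_zero, Finset.sum_singleton, hmap]
  have hf1 : ∀ a : Fin 1, IsPhys ((fun _ => f') a) := fun _ => hf'
  have hN := l2_dressed_recombine β hφ hf1 (fun _ => ε) (fun _ => ε)
  have hD := l2_dressed_transferApply_recombine β hφ hf1 (fun _ => ε) (fun _ => ε)
  rw [← hrec] at hN hD
  simp only [Finset.univ_unique, Fin.default_eq_zero, Finset.sum_singleton] at hN hD
  have e0 := hσinv f f (dressSteps L) (dressSteps L)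
  have e1 := hσinv f f (dressSteps L) (dressSteps L + 1)
  simp only [Function.iterate_succ_apply'] at e1
  constructor
  · calc l2 (dressedLiftVec β φ f) (dressedLiftVec β φ f) = _ := e0.symm
      _ = ε * ε * l2 (dressedLiftVec β φ f') (dressedLiftVec β φ f') := hN
      _ = _ := by rw [← sq, hε, one_mul]
  · calc l2 (dressedLiftVec β φ f) (transferApply β (dressedLiftVec β φ f)) = _ := e1.symm
      _ = ε * ε * l2 (dressedLiftVec β φ f') (transferApply β (dressedLiftVec β φ f')) := hD
      _ = _ := by rw [← sq, hε, one_mul]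

end Scalar

/-! ## §3 ★★ (o2) and (o6) for every basis of a scalar-block multiplet -/

section Clauses

variable {L : ℕ} [NeZero L] {n : ℕ}

/-- ★★ **∀-BASIS ROBUSTNESS INSIDE A MULTIPLET.**  Let `f : Fin n → (one-site functions)` be physical with SCALAR dressed Gram block `N(fₐ,f_b) = c·δ_ab`
and SCALAR coupling block `D(fₐ,f_b) = d·δ_ab` (raw vacuum `φ`; e.g. the symmetry-adapted basis of an irreducible `O_h`-multiplet: zeros by the
symmetry separations, equal diagonals by `l2_dressed_diag_eq_of_symmetry`).  If the channels `g_i`, `g_l` of a lift basis are recombinations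
`g_i = Σ pₐfₐ`, `g_l = Σ qₐfₐ` with ORTHOGONAL coefficient rows `Σ pₐqₐ = 0` (any rotated one-site-orthonormal basis of the multiplet), then clause (o2)
of `StaticClauses` (S-STAT) and clause (o6) of `DynamicCoreClauses` (S-POS) hold for the pair with ANY `C ≥ 0`. [cite: Luscher1983, §2] [cite: LuscherWolff1990] -/
theorem dressedLiftFamily_o2_o6_of_scalarBlock (β : ℝ) {φ : GaugeConfig 3 L SU2 → ℝ} (hvac : IsRawVacuum β φ)
    {f : Fin n → (GaugeConfig 3 1 SU2 → ℝ)} (hf : ∀ a, IsPhys (f a)) {c d : ℝ}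
    (hN : ∀ a b, l2 (dressedLiftVec β φ (f a)) (dressedLiftVec β φ (f b)) = if a = b then c else 0)
    (hD : ∀ a b, l2 (dressedLiftVec β φ (f a)) (transferApply β (dressedLiftVec β φ (f b))) = if a = b then d else 0)
    {B : ℝ} {k : ℕ} {ω : GaugeConfig 3 1 SU2 → ℝ} {g : Fin k → (GaugeConfig 3 1 SU2 → ℝ)} (hbasis : LiftBasis B k ω g)
    {C : ℝ} (hC : 0 ≤ C) (i l : Fin k) (p q : Fin n → ℝ) (hpq : ∑ a, p a * q a = 0)
    (hgi : ∀ V, g i V = ∑ a, p a * f a V) (hgl : ∀ V, g l V = ∑ a, q a * f a V) :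
    |l2 (dressedLiftFamily β φ g i) (dressedLiftFamily β φ g l)| ≤
        C * luscherLambda β L *
          (Real.sqrt (l2 (dressedLiftFamily β φ g i) (dressedLiftFamily β φ g i)) *
            Real.sqrt (l2 (dressedLiftFamily β φ g l) (dressedLiftFamily β φ g l))) ∧
      |l2 (dressedLiftFamily β φ g i) (transferApply β (dressedLiftFamily β φ g l)) -
          (l2 (dressedLiftFamily β φ g i) (transferApply β (dressedLiftFamily β φ g i)) /
                l2 (dressedLiftFamily β φ g i) (dressedLiftFamily β φ g i) +
              l2 (dressedLiftFamily β φ g l) (transferApply β (dressedLiftFamily β φ g l)) /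
                l2 (dressedLiftFamily β φ g l) (dressedLiftFamily β φ g l)) / 2 *
            l2 (dressedLiftFamily β φ g i) (dressedLiftFamily β φ g l)|
        ≤ C * (luscherLambda β L ^ 2 / L) * levelValue su2Rep L β 0 *
            (Real.sqrt (l2 (dressedLiftFamily β φ g i) (dressedLiftFamily β φ g i)) *
              Real.sqrt (l2 (dressedLiftFamily β φ g l) (dressedLiftFamily β φ g l))) := by
  have hφ : IsPhys φ := hvac.1
  have _hbasis := hbasis
  have hgi' : g i = fun V => ∑ a, p a * f a V := funext hgi
  have hgl' : g l = fun V => ∑ a, q a * f a V := funext hgl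
  have h0 : l2 (dressedLiftFamily β φ g i) (dressedLiftFamily β φ g l) = 0 := by
    show l2 (dressedLiftVec β φ (g i)) (dressedLiftVec β φ (g l)) = 0
    rw [hgi', hgl', l2_dressed_recombine_of_scalar β hφ hf hN p q, hpq, mul_zero]
  have h1 : l2 (dressedLiftFamily β φ g i) (transferApply β (dressedLiftFamily β φ g l)) = 0 := by
    show l2 (dressedLiftVec β φ (g i)) (transferApply β (dressedLiftVec β φ (g l))) = 0
    rw [hgi', hgl', l2_dressed_transferApply_recombine_of_scalar β hφ hf hD p q, hpq, mul_zero]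
  have hl0 : 0 ≤ levelValue su2Rep L β 0 := by rw [levelValue_zero]; exact topValue_nonneg su2Rep L β
  have hs : 0 ≤ Real.sqrt (l2 (dressedLiftFamily β φ g i) (dressedLiftFamily β φ g i)) *
      Real.sqrt (l2 (dressedLiftFamily β φ g l) (dressedLiftFamily β φ g l)) := mul_nonneg (Real.sqrt_nonneg _) (Real.sqrt_nonneg _)
  refine ⟨?_, ?_⟩
  · rw [h0, abs_zero]
    exact mul_nonneg (mul_nonneg hC (KTRCalibration.luscherLambda_nonneg β L)) hs
  · rw [h1, h0, mul_zero, sub_zero, abs_zero]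
    exact mul_nonneg (mul_nonneg (mul_nonneg hC (div_nonneg (sq_nonneg _) (Nat.cast_nonneg _))) hl0) hs

end Clauses

end Summit.QuantumFields.YangMills.Theorems.FemtoTransferGap.PolyakovLift

end
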